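import Summits.QuantumFields.YangMills.Theorems.BalabanUVNodesN15CurvedGluingCubeSmoothCutDressed
import Summits.QuantumFields.YangMills.Theorems.BalabanUVNodesN15CurvedGluingCubeDressedGeneralRemainderRowAdjoint
import HarnessLib

/-!
# Route «BalabanUVNodes» (cluster K4 «SpineRates»), Track-A DAG node N15 = NE2, BACKGROUND LAYER — THE DRESSED SMOOTH-CUT CUBE's ADJOINT REMAINDER ROW BY NAME: dag-n15-w5's output-localized
# row `X∘[Σ∇*∇ + W + N − 𝒱, M_h] ≤ 1_S(y)·θ₀ᴸ·e^{−ρ₃d}` (`hasMaj_dressedV_comp_commOp_cubeOp_out`, FILE 58's `hKcL`) run at `G₀ := M_{χ̃}N_□`, its flat-piece hypotheses (entry 0, the jet,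
# the RIGHT entries `G₀∘∇^±_μ`, `∇_jG₀∘∇^±_μ`, both cut-offs) discharged from FILE 63's left AND right cut rows and the bump (files 31∕34∕36)

Cell `pub-ymgap`, seat `pub-ymgap-dag-n15-w3` (WIDTH SEAT 3∕3 on node N15, director-ym №197 ∕ HUMAN RULING D-0149; plan `W-SEAT-START-LIST.md` §n15 item 3 «LG-vector + background layers at
GENERAL small-field U» — forty-first piece).  `bears_on: R4∕N15 · K3⁸ SpineGivenEndpointR13SepCoPHV (stmt-QuantumFields-27366; K3⁷ 20544 aside — KEY MAP v2)`.  Filed `--kind proof --supports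
stmt-QuantumFields-27366 --as helper` — COUNT-NEUTRAL.  Theorems only; 0 `sorry`.  Imports BY NAME file 34 `…SmoothCutDressed` (`hasMaj_smoothCut_flat`, `hasMaj_jet_smoothCut_flat`; file 31
`smoothCut_out`, `smoothCut_in`) and dag-n15-w5's `…CubeDressedGeneralRemainderRowAdjoint` (`hasMaj_dressedV_comp_commOp_cubeOp_out`); nothing in the tree is modified; nothing of dag-n15-w5's
restated.

WHY.  FILE 58's bundle reads each cube's remainder through TWO arrangements: the input-localized row `[K, M_h]∘X` (`hKc` — file 38 at the smooth cut) and the ADJOINT row `X∘[K, M_h]`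
(`hKcL`).  The latter is dag-n15-w5 g2's `hasMaj_dressedV_comp_commOp_cubeOp_out` for the general dressed cube with the STRUCTURAL perturbation `V̂ = V(C, A) + N_V∘pr₀`; at `G₀ = M_χ̃N_□`
its flat-piece hypotheses (`hG, hD`, the right entries `hGQf∕hDQf∕hGQb∕hDQb` with ONE letter, `hGχ, hGψ, hDq, hDqf, hDqb`) are files 31∕34's outputs, FILE 63's RIGHT cut rows of `N_□∘∇^±_μ`
and `∇_j N_□∘∇^±_μ` run through file 34's flat lemmas at `N := N_□∘∇^±_μ` (as file 36 did), and `rfl`s.  ★★★ `hasMaj_smoothCutDressed_comp_commOp_cubeOp_out` performs that instantiation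
once (`β ↦ β̄ = β + (β₁ + c̃β)`, `β₂ ↦ β̄^Q = β^Q + (β^Q₁ + c̃β^Q)`; the partition data, species rows `r_A`, the `W`-row `θ_W`, `[N, M_h]`'s letter and `N_V`'s letter stay displayed exactly as in
dag-n15-w5's theorem).

HONEST FRAMING ∕ LIMITS.  Pure instantiation; nothing of [B5]∕[B6]∕[B9] asserted ((1.120)–(1.128) pp.37–39, (2.91)–(2.92) p.239, (2.133)–(2.134) p.247, (3.52) p.400, (3.62)–(3.65)
pp.402–403, (3.76)–(3.77) pp.405–406 = SHAPES ∕ MECHANISM).  NE2⁺ NOT PRINTED, NOT proved; N15 NOT discharged; counts of record UNMOVED (typed 28∕28 · discharged 5∕27); one finite 𝕋⁴ at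
fixed ε — NOT infinite volume, NOT OS on ℝ⁴, NOT a mass gap, NOT Clay; R4 closes the conditional finite-𝕋⁴ rung `BalabanLadder.UV` only.
-/

set_option autoImplicit false

noncomputable section
open scoped BigOperators
open Finset

namespace Summit.QuantumFields.YangMills.BalabanUVNodes.N15.CurvedSpecies

open Literature.MathematicalPhysics.QuantumFieldTheory.Balaban1983to89
open Literature.MathematicalPhysics.QuantumFieldTheory.Balaban1983to89.B11SectG (BlockNorm HasMaj RowSum)
open Literature.MathematicalPhysics.QuantumFieldTheory.Balaban1983to89.B6RandomWalk (Triangle254)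
open Literature.MathematicalPhysics.QuantumFieldTheory.Balaban1983to89.B6Prop26Gluing (mulOp mulOp_apply ind ind_nonneg)
open Summit.QuantumFields.YangMills.BalabanUVNodes.N15.MatrixSpecies (liftBlk liftEquiv liftEquiv_apply liftEquiv_symm_apply)
open Summit.QuantumFields.YangMills.BalabanUVNodes.N15.BackgroundLayer (fgrad bgrad fgradAdj stack projO blkPair unstackM bgPropV projO_none_comp_stack)
open Summit.QuantumFields.YangMills.BalabanUVNodes.N15.Gluing (commOp lapOp)

variable {X ι J : Type} [Fintype X] [DecidableEq X] [Fintype ι] [DecidableEq ι] [Fintype J] [DecidableEq J] {g : B6.Geometry} (blk : X → g.Site) (τ : J → X ≃ X) (n : ℝ)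
  (C : X → Matrix ι ι ℝ) (A : J ⊕ J → X → Matrix ι ι ℝ) (hX : X → ℝ)
  {σ cr : ℝ} {N NV : (X × ι → ℝ) →ₗ[ℝ] (X × ι → ℝ)} {χX χtX ψX ψ₂X : X → ℝ} {S : Set g.Site} {β β₁ βQ βQ₁ ct δ : ℝ}

/-- ★★★ **FILE 58's `hKcL` ROW FOR THE DRESSED SMOOTH-CUT CUBE** — dag-n15-w5's `hasMaj_dressedV_comp_commOp_cubeOp_out` at `G₀ := M_χ̃N_□`: FILE 63's left cut rows (`β, β₁`) and RIGHT cut rows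
of `N_□∘∇^±_μ` (`β^Q`) and `∇^±_νN_□∘∇^±_μ` (`β^Q₁`), the bump (`|χ̃| ≤ 1`, `|∇^±χ̃| ≤ c̃`, insertions both ways), `N = NM_ψ` with the one-step margins `ψ₂`, the partition `h = h_X∘pr₁` (scalar
letters `c₁, c₀`, block reading `hb` with `ℓ, ω`, second differences `c₂`), the species rows `r_A`, the `W`-row `X∘[W, M_h] ≤ 1_S1_S·θ_We^{−ρ₂d}`, `[N, M_h] ≤ c_Ne^{−ρ_Nd}`, `N_V ≤ R_Ne^{−δ_Nd}`,
`V̂ = V(C, A) + N_V∘pr₀ ≤ Re^{−δ_Vd}`, `β̄Rc_r² < 1` ⟹ `X∘[Σ∇*∇ + W + N − 𝒱, M_h] ≤ 1_S(y)·θ₀ᴸ(β̄, β̄^Q)·e^{−ρ₃d}` with dag-n15-w5's constant at `β := β̄`, `β₂ := β̄^Q`.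
[cite: Balaban1984PropagatorsI, (1.120)–(1.128) pp.37–38, p.39 (adjoint representation); Balaban1984PropagatorsII, (2.91)–(2.92) p.239, (2.133)–(2.134) p.247 (shapes + mechanism); Balaban1985BackgroundPropagators, (3.52) p.400, (3.62)–(3.65) pp.402–403, (3.76)–(3.77) pp.405–406] -/
theorem hasMaj_smoothCutDressed_comp_commOp_cubeOp_out (htri : Triangle254 g) (hd : ∀ a b : g.Site, 0 ≤ g.dist a b) (hsymm : ∀ y y', g.dist y y' = g.dist y' y)
    (hrow : RowSum g σ cr) (hσ : 0 ≤ σ) {ρ₁ ρ₂ ρ₃ ρN δV δN ε R c₀ c₁ c₂ θW cN rA RN ℓ ω : ℝ} (hβ : 0 ≤ β) (hβ₁ : 0 ≤ β₁) (hβQ : 0 ≤ βQ) (hβQ₁ : 0 ≤ βQ₁) (hct : 0 ≤ ct)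
    (hR : 0 ≤ R) (hcr : 0 ≤ cr) (hσρ : σ ≤ ρ₁) (hρ₁V : ρ₁ ≤ δV) (hρ₁G : ρ₁ + σ ≤ δ) (hρ₂ : 0 ≤ ρ₂) (hρ₂₁ : ρ₂ + σ ≤ ρ₁) (hρ₃ : 0 ≤ ρ₃) (hρ₃N : ρ₃ ≤ ρN) (hρ₃V : ρ₃ ≤ δN - ε)
    (hρ₃₂ : ρ₃ + σ ≤ ρ₂) (hε : 0 < ε) (hc₀ : 0 ≤ c₀) (hc₁ : 0 ≤ c₁) (hc₂ : 0 ≤ c₂) (hθW : 0 ≤ θW) (hcN : 0 ≤ cN) (hrA : 0 ≤ rA) (hRN : 0 ≤ RN) (hℓ : 0 ≤ ℓ) (hω : 0 ≤ ω)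
    (hSχ : ∀ x, χX x ≠ 0 → blk x ∈ S) (hSψ : ∀ x, ψX x ≠ 0 → blk x ∈ S) (hSψ₂ : ∀ x, ψ₂X x ≠ 0 → blk x ∈ S)
    (hmf : ∀ μ x, ψX x ≠ 0 → ψ₂X x = 1 ∧ ψ₂X (τ μ x) = 1) (hmb : ∀ μ x, ψX x ≠ 0 → ψ₂X x = 1 ∧ ψ₂X ((τ μ).symm x) = 1)
    -- the bump and its insertions, the input cut-off
    (hχt : ∀ x, |χtX x| ≤ 1)
    (hdχt : ∀ μ p, |fgrad n (liftEquiv (τ μ) ι) (fun p : X × ι => χtX p.1) p| ≤ ct) (hdχtb : ∀ μ p, |bgrad n (liftEquiv (τ μ) ι) (fun p : X × ι => χtX p.1) p| ≤ ct)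
    (hsub : mulOp (fun p : X × ι => χtX p.1) ∘ₗ mulOp (fun p : X × ι => χX p.1) = mulOp (fun p : X × ι => χtX p.1))
    (hχ : mulOp (fun p : X × ι => χX p.1) ∘ₗ mulOp (fun p : X × ι => χtX p.1) = mulOp (fun p : X × ι => χtX p.1))
    (hs : ∀ μ, mulOp ((fun p : X × ι => χtX p.1) ∘ (liftEquiv (τ μ) ι)) ∘ₗ mulOp (fun p : X × ι => χX p.1) = mulOp ((fun p : X × ι => χtX p.1) ∘ (liftEquiv (τ μ) ι)))
    (hsb : ∀ μ, mulOp ((fun p : X × ι => χtX p.1) ∘ (liftEquiv (τ μ) ι).symm) ∘ₗ mulOp (fun p : X × ι => χX p.1) = mulOp ((fun p : X × ι => χtX p.1) ∘ (liftEquiv (τ μ) ι).symm))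
    (hdd : ∀ μ, mulOp (fgrad n (liftEquiv (τ μ) ι) (fun p : X × ι => χtX p.1)) ∘ₗ mulOp (fun p : X × ι => χX p.1) = mulOp (fgrad n (liftEquiv (τ μ) ι) (fun p : X × ι => χtX p.1)))
    (hddb : ∀ μ, mulOp (bgrad n (liftEquiv (τ μ) ι) (fun p : X × ι => χtX p.1)) ∘ₗ mulOp (fun p : X × ι => χX p.1) = mulOp (bgrad n (liftEquiv (τ μ) ι) (fun p : X × ι => χtX p.1)))
    (hNψ : N ∘ₗ mulOp (fun p : X × ι => ψX p.1) = N)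
    -- FILE 63's cut rows: left (`β, β₁`) and right (`β^Q, β^Q₁`)
    (hcut : HasMaj (BlockNorm.ofBlocks g (liftBlk blk ι)) (BlockNorm.ofBlocks g (liftBlk blk ι)) (mulOp (fun p : X × ι => χX p.1) ∘ₗ N) (fun y y' => ind S y * ind S y' * (β * Real.exp (-(δ * g.dist y y')))))
    (hcutF : ∀ μ, HasMaj (BlockNorm.ofBlocks g (liftBlk blk ι)) (BlockNorm.ofBlocks g (liftBlk blk ι)) (mulOp (fun p : X × ι => χX p.1) ∘ₗ (fgrad n (liftEquiv (τ μ) ι) ∘ₗ N)) (fun y y' => ind S y * ind S y' * (β₁ * Real.exp (-(δ * g.dist y y')))))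
    (hcutB : ∀ μ, HasMaj (BlockNorm.ofBlocks g (liftBlk blk ι)) (BlockNorm.ofBlocks g (liftBlk blk ι)) (mulOp (fun p : X × ι => χX p.1) ∘ₗ (bgrad n (liftEquiv (τ μ) ι) ∘ₗ N)) (fun y y' => ind S y * ind S y' * (β₁ * Real.exp (-(δ * g.dist y y')))))
    (hcutQf : ∀ μ, HasMaj (BlockNorm.ofBlocks g (liftBlk blk ι)) (BlockNorm.ofBlocks g (liftBlk blk ι)) (mulOp (fun p : X × ι => χX p.1) ∘ₗ (N ∘ₗ fgrad n (liftEquiv (τ μ) ι))) (fun y y' => ind S y * ind S y' * (βQ * Real.exp (-(δ * g.dist y y')))))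
    (hcutQb : ∀ μ, HasMaj (BlockNorm.ofBlocks g (liftBlk blk ι)) (BlockNorm.ofBlocks g (liftBlk blk ι)) (mulOp (fun p : X × ι => χX p.1) ∘ₗ (N ∘ₗ bgrad n (liftEquiv (τ μ) ι))) (fun y y' => ind S y * ind S y' * (βQ * Real.exp (-(δ * g.dist y y')))))
    (hcutFQf : ∀ μ ν, HasMaj (BlockNorm.ofBlocks g (liftBlk blk ι)) (BlockNorm.ofBlocks g (liftBlk blk ι)) (mulOp (fun p : X × ι => χX p.1) ∘ₗ (fgrad n (liftEquiv (τ ν) ι) ∘ₗ (N ∘ₗ fgrad n (liftEquiv (τ μ) ι)))) (fun y y' => ind S y * ind S y' * (βQ₁ * Real.exp (-(δ * g.dist y y')))))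
    (hcutBQf : ∀ μ ν, HasMaj (BlockNorm.ofBlocks g (liftBlk blk ι)) (BlockNorm.ofBlocks g (liftBlk blk ι)) (mulOp (fun p : X × ι => χX p.1) ∘ₗ (bgrad n (liftEquiv (τ ν) ι) ∘ₗ (N ∘ₗ fgrad n (liftEquiv (τ μ) ι)))) (fun y y' => ind S y * ind S y' * (βQ₁ * Real.exp (-(δ * g.dist y y')))))
    (hcutFQb : ∀ μ ν, HasMaj (BlockNorm.ofBlocks g (liftBlk blk ι)) (BlockNorm.ofBlocks g (liftBlk blk ι)) (mulOp (fun p : X × ι => χX p.1) ∘ₗ (fgrad n (liftEquiv (τ ν) ι) ∘ₗ (N ∘ₗ bgrad n (liftEquiv (τ μ) ι)))) (fun y y' => ind S y * ind S y' * (βQ₁ * Real.exp (-(δ * g.dist y y')))))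
    (hcutBQb : ∀ μ ν, HasMaj (BlockNorm.ofBlocks g (liftBlk blk ι)) (BlockNorm.ofBlocks g (liftBlk blk ι)) (mulOp (fun p : X × ι => χX p.1) ∘ₗ (bgrad n (liftEquiv (τ ν) ι) ∘ₗ (N ∘ₗ bgrad n (liftEquiv (τ μ) ι)))) (fun y y' => ind S y * ind S y' * (βQ₁ * Real.exp (-(δ * g.dist y y')))))
    {W NL : (X × ι → ℝ) →ₗ[ℝ] (X × ι → ℝ)} {hb : g.Site → ℝ}
    -- the partition: scalar letters, block-constant comparison, second differences on the vector carrier; the species rows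
    (hh1 : ∀ μ x, |fgrad n (τ μ) hX x| ≤ c₁) (hh1b : ∀ μ x, |bgrad n (τ μ) hX x| ≤ c₁) (hh0 : ∀ μ x, |hX (τ μ x) - hX x| ≤ c₀)
    (hLip : ∀ y y', |hb y - hb y'| ≤ ℓ * g.dist y y') (hrh : ∀ x, |hX x - hb (blk x)| ≤ ω)
    (hh2 : ∀ μ p, |fgradAdj n (liftEquiv (τ μ) ι) (fgrad n (liftEquiv (τ μ) ι) (fun p : X × ι => hX p.1)) p| ≤ c₂)
    (hh2f : ∀ μ p, |fgrad n (liftEquiv (τ μ) ι) (fgrad n (liftEquiv (τ μ) ι) (fun p : X × ι => hX p.1)) p| ≤ c₂)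
    (hh2b : ∀ μ p, |bgrad n (liftEquiv (τ μ) ι) (bgrad n (liftEquiv (τ μ) ι) (fun p : X × ι => hX p.1) ∘ ⇑(liftEquiv (τ μ) ι)) p| ≤ c₂)
    (hA : ∀ j x i, ∑ k, |A j x i k| ≤ rA)
    -- the perturbation's letter, smallness; the adjoint `W`-row on the dressed smooth-cut cube, the flat nonlocal summand's commutator letter, the base perturbation's letter
    (hV : HasMaj (BlockNorm.ofBlocks g (blkPair (liftBlk blk ι))) (BlockNorm.ofBlocks g (liftBlk blk ι)) (unstackM C A + NV ∘ₗ projO (none : Option (J ⊕ J))) (fun y y' => R * Real.exp (-(δV * g.dist y y'))))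
    (hq : (β + (β₁ + ct * β)) * (R * cr) * cr < 1)
    (hW : HasMaj (BlockNorm.ofBlocks g (liftBlk blk ι)) (BlockNorm.ofBlocks g (liftBlk blk ι)) ((projO none ∘ₗ bgPropV (stack (mulOp (fun p : X × ι => χtX p.1) ∘ₗ N)
        (fun j => Sum.elim (fun μ => fgrad n (liftEquiv (τ μ) ι)) (fun μ => bgrad n (liftEquiv (τ μ) ι)) j ∘ₗ (mulOp (fun p : X × ι => χtX p.1) ∘ₗ N))) (unstackM C A + NV ∘ₗ projO (none : Option (J ⊕ J)))) ∘ₗ commOp W (fun p : X × ι => hX p.1))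
      (fun y y' => ind S y * ind S y' * (θW * Real.exp (-(ρ₂ * g.dist y y')))))
    (hKN : HasMaj (BlockNorm.ofBlocks g (liftBlk blk ι)) (BlockNorm.ofBlocks g (liftBlk blk ι)) (commOp NL (fun p : X × ι => hX p.1)) (fun y y' => cN * Real.exp (-(ρN * g.dist y y'))))
    (hNV : HasMaj (BlockNorm.ofBlocks g (liftBlk blk ι)) (BlockNorm.ofBlocks g (liftBlk blk ι)) NV (fun y y' => RN * Real.exp (-(δN * g.dist y y')))) :
    HasMaj (BlockNorm.ofBlocks g (liftBlk blk ι)) (BlockNorm.ofBlocks g (liftBlk blk ι))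
      ((projO none ∘ₗ bgPropV (stack (mulOp (fun p : X × ι => χtX p.1) ∘ₗ N)
        (fun j => Sum.elim (fun μ => fgrad n (liftEquiv (τ μ) ι)) (fun μ => bgrad n (liftEquiv (τ μ) ι)) j ∘ₗ (mulOp (fun p : X × ι => χtX p.1) ∘ₗ N))) (unstackM C A + NV ∘ₗ projO (none : Option (J ⊕ J)))) ∘ₗ
        commOp (lapOp n (fun μ => liftEquiv (τ μ) ι) W + NL - (unstackM C A + NV ∘ₗ projO (none : Option (J ⊕ J))) ∘ₗ
          stack LinearMap.id (fun j => Sum.elim (fun μ => fgrad n (liftEquiv (τ μ) ι)) (fun μ => bgrad n (liftEquiv (τ μ) ι)) j)) (fun p : X × ι => hX p.1))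
      (fun y y' => ind S y * (((((Fintype.card J : ℝ) * (3 * ((β + (β₁ + ct * β)) * (1 - (β + (β₁ + ct * β)) * (R * cr) * cr)⁻¹ * c₂) + 2 * ((βQ + (βQ₁ + ct * βQ)) * (1 - (β + (β₁ + ct * β)) * (R * cr) * cr)⁻¹ * c₁)) + θW)
          + (β + (β₁ + ct * β)) * (1 - (β + (β₁ + ct * β)) * (R * cr) * cr)⁻¹ * cN * cr)
        + (((Fintype.card J : ℝ) * (2 * rA * (c₁ * ((β + (β₁ + ct * β)) * (1 - (β + (β₁ + ct * β)) * (R * cr) * cr)⁻¹) + c₀ * ((βQ + (βQ₁ + ct * βQ)) * (1 - (β + (β₁ + ct * β)) * (R * cr) * cr)⁻¹))))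
          + (β + (β₁ + ct * β)) * (1 - (β + (β₁ + ct * β)) * (R * cr) * cr)⁻¹ * ((ℓ * (Real.exp 1 * ε)⁻¹ + 2 * ω) * RN) * cr)) * Real.exp (-(ρ₃ * g.dist y y')))) := by
  have hβb : 0 ≤ (β + (β₁ + ct * β)) := by positivity
  have hβQb : 0 ≤ (βQ + (βQ₁ + ct * βQ)) := by positivity
  -- files 31∕34: the flat entry 0 and the jet of the smooth-cut cube
  have hG := hasMaj_smoothCut_flat blk (S := S) hβ hβ₁ hct hχt hsub hcut
  have hD := hasMaj_jet_smoothCut_flat blk τ n (S := S) hβ hβ₁ hct hχt hdχt hdχtb hs hsb hdd hddb hcut hcutF hcutB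
  -- the flat RIGHT entries `(M_χ̃N)∘∇^±_μ`, `∇_j(M_χ̃N)∘∇^±_μ` from the right cut rows (file 34 at `N := N∘∇^±_μ`)
  have hGQf : ∀ μ, HasMaj (BlockNorm.ofBlocks g (liftBlk blk ι)) (BlockNorm.ofBlocks g (liftBlk blk ι)) ((mulOp (fun p : X × ι => χtX p.1) ∘ₗ N) ∘ₗ fgrad n (liftEquiv (τ μ) ι)) (fun y y' => (βQ + (βQ₁ + ct * βQ)) * Real.exp (-(δ * g.dist y y'))) := fun μ => by
    rw [LinearMap.comp_assoc]
    exact hasMaj_smoothCut_flat blk (S := S) hβQ hβQ₁ hct hχt hsub (hcutQf μ)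
  have hGQb : ∀ μ, HasMaj (BlockNorm.ofBlocks g (liftBlk blk ι)) (BlockNorm.ofBlocks g (liftBlk blk ι)) ((mulOp (fun p : X × ι => χtX p.1) ∘ₗ N) ∘ₗ bgrad n (liftEquiv (τ μ) ι)) (fun y y' => (βQ + (βQ₁ + ct * βQ)) * Real.exp (-(δ * g.dist y y'))) := fun μ => by
    rw [LinearMap.comp_assoc]
    exact hasMaj_smoothCut_flat blk (S := S) hβQ hβQ₁ hct hχt hsub (hcutQb μ)
  have hDQf : ∀ μ (j : J ⊕ J), HasMaj (BlockNorm.ofBlocks g (liftBlk blk ι)) (BlockNorm.ofBlocks g (liftBlk blk ι))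
      ((Sum.elim (fun μ => fgrad n (liftEquiv (τ μ) ι)) (fun μ => bgrad n (liftEquiv (τ μ) ι)) j ∘ₗ (mulOp (fun p : X × ι => χtX p.1) ∘ₗ N)) ∘ₗ fgrad n (liftEquiv (τ μ) ι)) (fun y y' => (βQ + (βQ₁ + ct * βQ)) * Real.exp (-(δ * g.dist y y'))) := fun μ j => by
    rw [LinearMap.comp_assoc, LinearMap.comp_assoc]
    exact hasMaj_jet_smoothCut_flat blk τ n (S := S) hβQ hβQ₁ hct hχt hdχt hdχtb hs hsb hdd hddb (hcutQf μ) (hcutFQf μ) (hcutBQf μ) j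
  have hDQb : ∀ μ (j : J ⊕ J), HasMaj (BlockNorm.ofBlocks g (liftBlk blk ι)) (BlockNorm.ofBlocks g (liftBlk blk ι))
      ((Sum.elim (fun μ => fgrad n (liftEquiv (τ μ) ι)) (fun μ => bgrad n (liftEquiv (τ μ) ι)) j ∘ₗ (mulOp (fun p : X × ι => χtX p.1) ∘ₗ N)) ∘ₗ bgrad n (liftEquiv (τ μ) ι)) (fun y y' => (βQ + (βQ₁ + ct * βQ)) * Real.exp (-(δ * g.dist y y'))) := fun μ j => by
    rw [LinearMap.comp_assoc, LinearMap.comp_assoc]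
    exact hasMaj_jet_smoothCut_flat blk τ n (S := S) hβQ hβQ₁ hct hχt hdχt hdχtb hs hsb hdd hddb (hcutQb μ) (hcutFQb μ) (hcutBQb μ) j
  exact hasMaj_dressedV_comp_commOp_cubeOp_out blk τ n C A hX htri hd hsymm hrow hσ hβb hβQb hR hcr hσρ hρ₁V hρ₁G hρ₂ hρ₂₁ hρ₃ hρ₃N hρ₃V hρ₃₂ hε hc₀ hc₁ hc₂ hθW hcN hrA hRN hℓ hω
    (fun _ => rfl) (fun _ => rfl) (fun _ => rfl) hSχ hSψ hSψ₂ hmf hmb (smoothCut_out hχ) (smoothCut_in hNψ) hh1 hh1b hh0 hLip hrh hh2 hh2f hh2b hA hG hD hGQf hDQf hGQb hDQb hV hq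
    hW hKN hNV

end Summit.QuantumFields.YangMills.BalabanUVNodes.N15.CurvedSpecies

end
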